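import Literature.NumberTheory.LFunctions.Zhang2022.Section8Ded811Engine
import Literature.NumberTheory.LFunctions.Zhang2022.Section8FrontEnd810
import Literature.NumberTheory.LFunctions.Zhang2022.RepairGapSection8GatheringPremise
import HarnessLib

/-!
# Zhang (2022), rescue GAP/BED (D-0124 (3)(4)): §8 p. 48 — the substituted display Z22:§8.u046, (8.11) and (8.12)
# (`Section8cStatements.Step8u046` / `Eq811` / `Eq812`, the §8 main-term input of the (8.23) evaluation) under the minimum premise
# `‖L(1,χ)‖ ≤ 𝓛⁻¹⁵`, UNCONDITIONAL for every `c′ ≥ 0`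

Topic `Literature/NumberTheory/LFunctions/Zhang2022` (Landau–Siegel audit tree; verdict-neutral).
Y. Zhang, *Discrete mean estimates and the Landau–Siegel zero*, arXiv:2211.02515v1 (2022)
[Zhang2022LandauSiegel] — **an unrefereed manuscript under adjudication; nothing in this file asserts or
denies its Theorems 1–2, and nothing here is a claim about Landau–Siegel zeros. The programme SEARCHES and
TYPES; no claim about Landau–Siegel zeros, Theorems 1–2 of arXiv:2211.02515 or a repaired Margin232 until a
kernel theorem says so.**

The tree closes (8.12) — `Section8cStatements.Eq812 c′`, «`S_j(𝐚₁₁,𝐚₂₁) = 𝔞·S812(…) + o(α)`», the input `h812` of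
`Section8Ded823.eval823_of_eq812 : Eq812 c′ → Eq87 c′ → Prop71 c′ → Eval823 c′` — by `Section8FrontEnd44ReductionRel.eq812_of_lemma84Rel`:
gathering u044 (now `step8u044_pow15`, `RepairGapSection8GatheringPremise`), the substitution `n = dr` with (8.10) (`Section8FrontEnd810.dedStep8u046_of`,
a THREAD; (8.10) `eq810_holds` is an unguarded identity), partial integration (8.11) (`Section8Ded811Engine.eq811_of_step8u046`, a THREAD over the
guard-free range-sum engine) and the change of variables (8.12) (`Section8cStatements.ded812_holds`, `S811 = S812`). This file re-runs the three
edges VERBATIM with the guard text `AssumptionA D χ →` replaced by `‖L(1,χ)‖ ≤ 𝓛⁻¹⁵ →` (`dedStep8u046_pow15_of`, `eq811_pow15_of_step8u046`,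
`eq812_pow15_of_eq811`), whence **`step8u046_pow15`, `eq811_pow15`, and `eq812_pow15` — the body of `Eq812 c′` at guard `𝓛⁻¹⁵`, every
`c′ ≥ 0`, UNCONDITIONAL** — with `eq812_of_assumptionAWith` (every real `E ≥ 15`; at `E = 2022` the body of the tree theorem
`eq812_of_lemma84Rel hc′ (Skeleton.lemma84Rel_holds c′)`, not restated). GAP reading (as-typed, planner-grade): the §8 main-term input (8.12) of
node (8.23) is kernel at E = 15; (8.23) itself (`Eval823With`) also consumes (8.7) = `Eq87` (Prop 2.2 / Lemma 2.3 / Lemma 8.1 — Part I) and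
Prop 7.1, so the NODE stays at the printed exponent (exactly as for (9.7) / (10.17)). Theorems only; no definition, no named fact; nothing
about (A) itself.

## References

* Y. Zhang, arXiv:2211.02515v1 (2022), §8 (8.10)–(8.12) p. 48 (tex L2448–L2473). [cite: Zhang2022LandauSiegel, §8 (8.12) p.48]
-/

noncomputable section

open Complex Real ComplexConjugate Set MeasureTheory Finset

/-! ## §8.u046 at `𝓛⁻¹⁵` (substituting `n = dr`) -/

namespace Literature.NumberTheory.LFunctions.Zhang2022.Section8FrontEnd810

open Literature.NumberTheory.LFunctions.Zhang2022.Skeleton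
open Literature.NumberTheory.LFunctions.Zhang2022.Section8cStatements (mFac nFac diagFac)

/-- **The substitution step «It follows, by substituting `n = dr`, that …» at (A)-exponent 15** (twin of `dedStep8u046_of` for ARBITRARY
profiles `F`, `G`, proof verbatim, guard swapped). [cite: Zhang2022LandauSiegel, §8 display after (8.10) p.48, tex L2451] -/
theorem dedStep8u046_pow15_of (c' : ℝ) (F G : ℕ → ℕ → ℕ → ℂ)
    (h44 : ∀ ε : ℝ, 0 < ε → ForAllLarge fun D _ χ => ‖χ.LFunction 1‖ ≤ 1 / Real.log D ^ 15 →
      ∀ j ∈ ({1, 2, 3} : Finset ℕ),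
        ‖Sj c' D j (a11 χ) (a21 χ) -
            (deriv χ.LFunction 1 ^ 2 *
                (∑ n ∈ Finset.Ico 1 ⌈Skeleton.P2 D⌉₊, ∑ p ∈ Nat.divisorsAntidiagonal n,
                  ((ArithmeticFunction.moebius p.2).natAbs : ℂ) *
                        (‖χ ((p.1 * p.2 : ℕ) : ZMod D)‖ : ℂ) /
                      (((p.1 * p.2 : ℕ) : ℂ) * (Nat.totient p.2 : ℂ)) *
                    lamZero c' D j (p.1 * p.2) * PiW χ p.1 p.2 * F D j n) +
              deriv χ.LFunction 1 ^ 2 *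
                (∑ n ∈ Finset.Ico ⌈Skeleton.P2 D⌉₊ ⌈Skeleton.P1 D⌉₊, ∑ p ∈ Nat.divisorsAntidiagonal n,
                  ((ArithmeticFunction.moebius p.2).natAbs : ℂ) *
                        (‖χ ((p.1 * p.2 : ℕ) : ZMod D)‖ : ℂ) /
                      (((p.1 * p.2 : ℕ) : ℂ) * (Nat.totient p.2 : ℂ)) *
                    lamZero c' D j (p.1 * p.2) * PiW χ p.1 p.2 * G D j n))‖
          ≤ ε * alpha D)
    (h810 : ∀ (D : ℕ) [NeZero D] (χ : DirichletCharacter ℂ D), χ.IsQuadratic → ∀ n : ℕ, n ≠ 0 →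
      ∑ r ∈ n.divisors with Squarefree r, (1 / (Nat.totient r : ℂ)) * PiW χ (n / r) r
        = (n : ℂ) / (Nat.totient n : ℂ)) :
    ∀ ε : ℝ, 0 < ε → ForAllLarge fun D _ χ => ‖χ.LFunction 1‖ ≤ 1 / Real.log D ^ 15 →
      ∀ j ∈ ({1, 2, 3} : Finset ℕ),
        ‖Sj c' D j (a11 χ) (a21 χ) -
            (deriv χ.LFunction 1 ^ 2 *
                (∑ n ∈ Finset.Ico 1 ⌈Skeleton.P2 D⌉₊,
                  (‖χ (n : ZMod D)‖ : ℂ) * lamZero c' D j n / (Nat.totient n : ℂ) * F D j n) +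
              deriv χ.LFunction 1 ^ 2 *
                (∑ n ∈ Finset.Ico ⌈Skeleton.P2 D⌉₊ ⌈Skeleton.P1 D⌉₊,
                  (‖χ (n : ZMod D)‖ : ℂ) * lamZero c' D j n / (Nat.totient n : ℂ) * G D j n))‖
          ≤ ε * alpha D := by
  intro ε hε
  refine (h44 ε hε).mono ?_
  intro D _ χ hq _ h hA j hj
  have key := h hA j hj
  have hP2 : 0 < Skeleton.P2 D :=
    div_pos (Real.rpow_pos_of_pos (Real.exp_pos _) _) (pow_pos (Real.exp_pos _) _)
  have h1 : ∀ n ∈ Finset.Ico 1 ⌈Skeleton.P2 D⌉₊, n ≠ 0 := fun n hn => by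
    rw [Finset.mem_Ico] at hn; omega
  have h2 : ∀ n ∈ Finset.Ico ⌈Skeleton.P2 D⌉₊ ⌈Skeleton.P1 D⌉₊, n ≠ 0 := fun n hn => by
    rw [Finset.mem_Ico] at hn
    have : 0 < ⌈Skeleton.P2 D⌉₊ := Nat.ceil_pos.mpr hP2
    omega
  rw [Finset.sum_congr rfl (fun n hn =>
      sum_antidiagonal_weight χ c' j (h810 D χ hq) (h1 n hn) (F D j n)),
    Finset.sum_congr rfl (fun n hn =>
      sum_antidiagonal_weight χ c' j (h810 D χ hq) (h2 n hn) (G D j n))] at key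
  exact key

/-- **Z22:§8.u046 at (A)-exponent 15, UNCONDITIONAL, every `c′ ≥ 0`** — the body of `Section8cStatements.Step8u046 c′` with its guard
`AssumptionA D χ` replaced by `‖L(1,χ)‖ ≤ 𝓛⁻¹⁵`: `dedStep8u046_pow15_of` at the gathering `step8u044_pow15` and (8.10) `eq810_holds` (as the tree's
`dedStep8u046_holds`). [cite: Zhang2022LandauSiegel, §8 display after (8.10) p.48, tex L2452] -/
theorem step8u046_pow15 {c' : ℝ} (hc' : 0 ≤ c') :
    ∀ ε : ℝ, 0 < ε → ForAllLarge fun D _ χ => ‖χ.LFunction 1‖ ≤ 1 / Real.log D ^ 15 →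
      ∀ j ∈ ({1, 2, 3} : Finset ℕ),
        ‖Sj c' D j (a11 χ) (a21 χ) -
            (deriv χ.LFunction 1 ^ 2 *
                (∑ n ∈ Finset.Ico 1 ⌈Skeleton.P2 D⌉₊,
                  (‖χ (n : ZMod D)‖ : ℂ) * lamZero c' D j n / (Nat.totient n : ℂ) *
                    (mFac c' D j n * nFac c' D j n)) +
              deriv χ.LFunction 1 ^ 2 *
                (∑ n ∈ Finset.Ico ⌈Skeleton.P2 D⌉₊ ⌈Skeleton.P1 D⌉₊,
                  (‖χ (n : ZMod D)‖ : ℂ) * lamZero c' D j n / (Nat.totient n : ℂ) * diagFac c' D j n))‖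
          ≤ ε * alpha D :=
  dedStep8u046_pow15_of c'
    (fun D j n => Section8cStatements.mFac c' D j n * Section8cStatements.nFac c' D j n)
    (fun D j n => Section8cStatements.diagFac c' D j n)
    (Section8FrontEnd44ReductionRel.step8u044_pow15 hc') eq810_holds

end Literature.NumberTheory.LFunctions.Zhang2022.Section8FrontEnd810

/-! ## (8.11) and (8.12) at `𝓛⁻¹⁵` -/

namespace Literature.NumberTheory.LFunctions.Zhang2022.Section8Ded811Engine

open Skeleton Section8cStatements Section8AbelProfiles Section8RangeEngine

/-- **(8.11) from §8.u046 at (A)-exponent 15** (twin of `eq811_of_step8u046`: partial integration through the guard-free range-sum engine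
`weighted_sum_integral_eval`; proof verbatim, guard swapped). [cite: Zhang2022LandauSiegel, §8 (8.11) p.48, tex L2452–L2469] -/
theorem eq811_pow15_of_step8u046 (c' : ℝ)
    (h46 : ∀ ε : ℝ, 0 < ε → ForAllLarge fun D _ χ => ‖χ.LFunction 1‖ ≤ 1 / Real.log D ^ 15 →
      ∀ j ∈ ({1, 2, 3} : Finset ℕ),
        ‖Sj c' D j (a11 χ) (a21 χ) -
            (deriv χ.LFunction 1 ^ 2 *
                (∑ n ∈ Finset.Ico 1 ⌈Skeleton.P2 D⌉₊,
                  (‖χ (n : ZMod D)‖ : ℂ) * lamZero c' D j n / (Nat.totient n : ℂ) *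
                    (mFac c' D j n * nFac c' D j n)) +
              deriv χ.LFunction 1 ^ 2 *
                (∑ n ∈ Finset.Ico ⌈Skeleton.P2 D⌉₊ ⌈Skeleton.P1 D⌉₊,
                  (‖χ (n : ZMod D)‖ : ℂ) * lamZero c' D j n / (Nat.totient n : ℂ) * diagFac c' D j n))‖
          ≤ ε * alpha D) :
    ∀ ε : ℝ, 0 < ε → ForAllLarge fun D _ χ => ‖χ.LFunction 1‖ ≤ 1 / Real.log D ^ 15 →
      ∀ j ∈ ({1, 2, 3} : Finset ℕ),
        ‖Sj c' D j (a11 χ) (a21 χ) -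
            (frakA χ : ℂ) * S811 (frakfW c' D j 6) (frakfW c' D j 7) (frakgW c' D j 6) (frakgW c' D j 7)
              (ell D ^ 9) 0.504 (theta2 D)‖
          ≤ ε * alpha D := by
  intro ε hε
  obtain ⟨C, hE⟩ := weighted_sum_integral_eval c'
  set Q : ℝ := (423400 + 2674500 * π) + 2 * (16936 + 106980 * π) with hQ
  have FL : ForAllLarge fun D _ _ =>
      3 ≤ ell D ∧ 5 * |c'| * π ≤ ell D ∧ 2 * |C| * Q / (ε * π) ≤ ell D :=
    ForAllLarge.of_le (max 21 (max ⌈Real.exp (5 * |c'| * π)⌉₊ ⌈Real.exp (2 * |C| * Q / (ε * π))⌉₊))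
      fun D _ _ hD _ _ =>
        ⟨Section8Ded823.three_le_ell (le_trans (le_max_left _ _) hD),
          Section8Ded823.le_ell_of_le (le_trans ((le_max_left _ _).trans (le_max_right _ _)) hD),
          Section8Ded823.le_ell_of_le (le_trans ((le_max_right _ _).trans (le_max_right _ _)) hD)⟩
  refine (((h46 (ε / 2) (by positivity)).and hE).and FL).mono ?_
  intro D _ χ hq hp h hA j hj
  obtain ⟨⟨e46, eng⟩, hℓ3, hc5, hCQ⟩ := h
  replace e46 := e46 hA j hj
  replace eng := eng j hj
  -- parameters
  have hℓ0 : 0 < ell D := by linarith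
  have hℓ1 : 1 ≤ ell D := by linarith
  have hℓne : ell D ≠ 0 := hℓ0.ne'
  have h9 : 0 < ell D ^ 9 := by positivity
  have hα : alpha D = π / ell D ^ 9 := by rw [Skeleton.alpha, log_bigP]
  have hα0 : 0 < alpha D := by rw [hα]; positivity
  have hc : 5 * |c'| * alpha D * ell D ≤ 1 := by
    have h8 : ell D ≤ ell D ^ 8 := le_self_pow₀ hℓ1 (by norm_num)
    have e : 5 * |c'| * alpha D * ell D = 5 * |c'| * π / ell D ^ 8 := by
      rw [hα]; field_simp
    rw [e, div_le_one (by positivity)]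
    linarith
  obtain ⟨hL1, hL2⟩ := log_P1_P2 hℓne (D := D)
  obtain ⟨hθ1, hθ2⟩ := theta2_mem (by linarith : 2 ≤ ell D)
  have hP1pos : 0 < Skeleton.P1 D := by rw [← Ppow_theta1]; exact Ppow_pos _ _
  have hP2pos : 0 < Skeleton.P2 D := by rw [← Ppow_theta2 D hℓne]; exact Ppow_pos _ _
  have hlogP1 : 0 < Real.log (Skeleton.P1 D) := by rw [hL1]; positivity
  have hlogP2 : 0 < Real.log (Skeleton.P2 D) := by rw [hL2]; positivity
  have h39 : (3 : ℝ) ^ 9 ≤ ell D ^ 9 := pow_le_pow_left₀ (by norm_num) hℓ3 9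
  have hP2two : 2 ≤ Skeleton.P2 D := by
    have h1 : (1 : ℝ) ≤ Real.log (Skeleton.P2 D) := by rw [hL2]; nlinarith
    have h2 : Real.exp 1 ≤ Skeleton.P2 D := by
      rw [← Real.exp_log hP2pos]; exact Real.exp_le_exp.mpr h1
    have h3 : (2 : ℝ) ≤ Real.exp 1 := by have := Real.exp_one_gt_d9; linarith
    linarith
  have hP21 : Skeleton.P2 D ≤ Skeleton.P1 D := by
    rw [← Real.log_le_log_iff hP2pos hP1pos, hL1, hL2]; nlinarith
  have hP1two : 2 ≤ Skeleton.P1 D := le_trans hP2two hP21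
  have hP1P : Skeleton.P1 D ≤ bigP D := by
    have hPpos : 0 < bigP D := Real.exp_pos _
    rw [← Real.log_le_log_iff hP1pos hPpos, hL1, log_bigP]; nlinarith
  have hP2P : Skeleton.P2 D ≤ bigP D := hP21.trans hP1P
  set T : ℝ := Skeleton.P1 D + 1 with hT
  have hTα : alpha D * Real.log T ≤ 4 := by
    rw [hα]; exact alpha_log_succ_P1_le hℓ3 hP1pos hL1 (by linarith)
  set κ : ℝ := 1 / Real.log (Skeleton.P1 D) + ‖iota2‖ / Real.log (Skeleton.P2 D) with hκ
  have hκ0 : 0 ≤ κ := by positivity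
  have hκ10 : κ ≤ 10 / ell D ^ 9 := by rw [hκ, hL1, hL2]; exact kappa_le hℓ3 hθ1
  -- the two profiles and their bounds on `[1, T]`
  set FF : ℝ → ℂ := fun u => mFac c' D j u * nFac c' D j u with hFF
  have bF : ∀ t ∈ Set.Icc 1 T, DifferentiableAt ℝ FF t ∧ ‖FF t‖ ≤ 29 * κ * (146 * κ) ∧
      ‖deriv FF t‖ ≤ (94 * alpha D * κ * (146 * κ) + 29 * κ * (449 * alpha D * κ)) / t := by
    intro t ht
    obtain ⟨dm, nm, nm'⟩ := mFac_bounds c' j hα0 hℓ0.le hc (by linarith) (by linarith) (le_of_lt (by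
      rw [hT]; linarith)) (by rw [hT]; linarith) ht.1 ht.2 hTα hlogP1 hlogP2
    obtain ⟨dn, nn, nn'⟩ := nFac_bounds c' j hα0 hℓ0.le hc (by linarith) (by linarith) (le_of_lt (by
      rw [hT]; linarith)) (by rw [hT]; linarith) ht.1 ht.2 hTα hlogP1 hlogP2
    exact mul_bounds dm dn nm nn nm' nn' (by positivity)
  have bG : ∀ t ∈ Set.Icc 1 T, DifferentiableAt ℝ (diagFac c' D j) t ∧
      ‖diagFac c' D j t‖ ≤ 4234 / Real.log (Skeleton.P1 D) ^ 2 ∧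
      ‖deriv (diagFac c' D j) t‖ ≤ 26745 * alpha D / Real.log (Skeleton.P1 D) ^ 2 / t :=
    fun t ht => diagFac_bounds c' j hα0 hℓ0.le hc (by linarith) (le_of_lt (by rw [hT]; linarith))
      ht.1 ht.2 hTα hlogP1
  -- the three engine applications
  have engF := eng (Skeleton.P2 D) (29 * κ * (146 * κ))
    (94 * alpha D * κ * (146 * κ) + 29 * κ * (449 * alpha D * κ)) FF hP2two hP2P (by positivity)
    (by positivity) (fun t ht => (bF t ⟨ht.1, by rw [hT]; linarith [ht.2]⟩).1)
    (fun t ht => (bF t ⟨ht.1, by rw [hT]; linarith [ht.2]⟩).2.1)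
    (fun t ht => (bF t ⟨ht.1, by rw [hT]; linarith [ht.2]⟩).2.2)
  have engG1 := eng (Skeleton.P1 D) (4234 / Real.log (Skeleton.P1 D) ^ 2)
    (26745 * alpha D / Real.log (Skeleton.P1 D) ^ 2) (diagFac c' D j) hP1two hP1P (by positivity)
    (by positivity) (fun t ht => (bG t ⟨ht.1, by rw [hT]; linarith [ht.2]⟩).1)
    (fun t ht => (bG t ⟨ht.1, by rw [hT]; linarith [ht.2]⟩).2.1)
    (fun t ht => (bG t ⟨ht.1, by rw [hT]; linarith [ht.2]⟩).2.2)
  have engG2 := eng (Skeleton.P2 D) (4234 / Real.log (Skeleton.P1 D) ^ 2)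
    (26745 * alpha D / Real.log (Skeleton.P1 D) ^ 2) (diagFac c' D j) hP2two hP2P (by positivity)
    (by positivity) (fun t ht => (bG t ⟨ht.1, by rw [hT]; linarith [ht.2]⟩).1)
    (fun t ht => (bG t ⟨ht.1, by rw [hT]; linarith [ht.2]⟩).2.1)
    (fun t ht => (bG t ⟨ht.1, by rw [hT]; linarith [ht.2]⟩).2.2)
  -- numeric size of the three errors
  have errF := errF_le (C := C) hℓ3 hκ0 hκ10
  have errG := errG_le (C := C) hℓ3 hL1
  rw [← hα] at errF errG
  have htot := total_err_le hℓ3 hε hCQ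
  -- names
  set L2 : ℂ := deriv χ.LFunction 1 ^ 2 with hL2def
  set w : ℕ → ℂ := fun n => (‖χ (n : ZMod D)‖ : ℂ) * lamZero c' D j n / (Nat.totient n : ℂ) with hw
  set N1 : ℕ := ⌈Skeleton.P1 D⌉₊ with hN1
  set N2 : ℕ := ⌈Skeleton.P2 D⌉₊ with hN2
  have hN12 : N2 ≤ N1 := Nat.ceil_mono hP21
  have hN2one : 1 ≤ N2 := Nat.one_le_ceil_iff.mpr (by linarith)
  set SF : ℂ := ∑ n ∈ Finset.Ico 1 N2, w n * FF n with hSF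
  set SG1 : ℂ := ∑ n ∈ Finset.Ico 1 N1, w n * diagFac c' D j n with hSG1
  set SG2 : ℂ := ∑ n ∈ Finset.Ico 1 N2, w n * diagFac c' D j n with hSG2
  set SG : ℂ := ∑ n ∈ Finset.Ico N2 N1, w n * diagFac c' D j n with hSG
  set IF : ℂ := ∫ t in (1 : ℝ)..Skeleton.P2 D, FF t / t with hIF
  set IG1 : ℂ := ∫ t in (1 : ℝ)..Skeleton.P1 D, diagFac c' D j t / t with hIG1
  set IG2 : ℂ := ∫ t in (1 : ℝ)..Skeleton.P2 D, diagFac c' D j t / t with hIG2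
  set IG : ℂ := ∫ t in Skeleton.P2 D..Skeleton.P1 D, diagFac c' D j t / t with hIG
  have hSG_split : SG = SG1 - SG2 := by
    rw [hSG, hSG1, hSG2, ← Finset.sum_Ico_consecutive _ hN2one hN12]
    ring
  have hGcont : ContinuousOn (fun t : ℝ => diagFac c' D j t / (t : ℂ)) (Set.Icc 1 T) := by
    refine ContinuousOn.div (fun t ht => (bG t ht).1.continuousAt.continuousWithinAt)
      Complex.continuous_ofReal.continuousOn fun t ht => ?_
    exact_mod_cast (by linarith [ht.1] : t ≠ 0)
  have hIG_split : IG = IG1 - IG2 := by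
    rw [hIG, hIG1, hIG2, intervalIntegral.integral_interval_sub_left]
    · exact (hGcont.mono fun t ht => by
        rw [Set.uIcc_of_le (by linarith : (1:ℝ) ≤ Skeleton.P1 D)] at ht
        exact ⟨ht.1, by rw [hT]; linarith [ht.2]⟩).intervalIntegrable
    · exact (hGcont.mono fun t ht => by
        rw [Set.uIcc_of_le (by linarith : (1:ℝ) ≤ Skeleton.P2 D)] at ht
        exact ⟨ht.1, by rw [hT]; linarith [ht.2]⟩).intervalIntegrable
  -- the target
  rw [S811_eq_integrals c' hℓne j]
  have e46' : ‖Sj c' D j (a11 χ) (a21 χ) - (L2 * SF + L2 * SG)‖ ≤ ε / 2 * alpha D := by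
    have := e46
    simpa only [hL2def, hSF, hSG, hw, hFF, hN1, hN2] using this
  have key : Sj c' D j (a11 χ) (a21 χ) - (frakA χ : ℂ) * (IF + IG) =
      (Sj c' D j (a11 χ) (a21 χ) - (L2 * SF + L2 * SG)) + (L2 * SF - (frakA χ : ℂ) * IF) +
        ((L2 * SG1 - (frakA χ : ℂ) * IG1) - (L2 * SG2 - (frakA χ : ℂ) * IG2)) := by
    rw [hSG_split, hIG_split]; ring
  have engF' : ‖L2 * SF - (frakA χ : ℂ) * IF‖ ≤ |C| * (423400 + 2674500 * π) / ell D ^ 12 :=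
    engF.trans errF
  have engG1' : ‖L2 * SG1 - (frakA χ : ℂ) * IG1‖ ≤ |C| * (16936 + 106980 * π) / ell D ^ 12 :=
    engG1.trans errG
  have engG2' : ‖L2 * SG2 - (frakA χ : ℂ) * IG2‖ ≤ |C| * (16936 + 106980 * π) / ell D ^ 12 :=
    engG2.trans errG
  have hIFG : IF + IG = (∫ t in (1 : ℝ)..Skeleton.P2 D, mFac c' D j t * nFac c' D j t / t) +
      ∫ t in Skeleton.P2 D..Skeleton.P1 D, diagFac c' D j t / t := by rw [hIF, hIG]
  rw [← hIFG, key]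
  calc ‖(Sj c' D j (a11 χ) (a21 χ) - (L2 * SF + L2 * SG)) + (L2 * SF - (frakA χ : ℂ) * IF) +
        ((L2 * SG1 - (frakA χ : ℂ) * IG1) - (L2 * SG2 - (frakA χ : ℂ) * IG2))‖
      ≤ ‖Sj c' D j (a11 χ) (a21 χ) - (L2 * SF + L2 * SG)‖ + ‖L2 * SF - (frakA χ : ℂ) * IF‖ +
        ‖(L2 * SG1 - (frakA χ : ℂ) * IG1) - (L2 * SG2 - (frakA χ : ℂ) * IG2)‖ := norm_add₃_le
    _ ≤ ε / 2 * alpha D + |C| * (423400 + 2674500 * π) / ell D ^ 12 +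
        (|C| * (16936 + 106980 * π) / ell D ^ 12 + |C| * (16936 + 106980 * π) / ell D ^ 12) :=
        add_le_add (add_le_add e46' engF') ((norm_sub_le _ _).trans (add_le_add engG1' engG2'))
    _ = ε / 2 * alpha D + |C| * Q / ell D ^ 12 := by rw [hQ]; ring
    _ ≤ ε / 2 * alpha D + ε / 2 * alpha D := by rw [hα]; exact add_le_add le_rfl htot
    _ = ε * alpha D := by ring

/-- **(8.12) from (8.11) at (A)-exponent 15** (twin of `Section8cStatements.ded812_holds`: the change of variables `S811 = S812`, kernel for all
continuous profiles; proof verbatim, guard swapped). [cite: Zhang2022LandauSiegel, §8 (8.11)–(8.12) p.48, tex L2472] -/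
theorem eq812_pow15_of_eq811 (c' : ℝ)
    (h811 : ∀ ε : ℝ, 0 < ε → ForAllLarge fun D _ χ => ‖χ.LFunction 1‖ ≤ 1 / Real.log D ^ 15 →
      ∀ j ∈ ({1, 2, 3} : Finset ℕ),
        ‖Sj c' D j (a11 χ) (a21 χ) -
            (frakA χ : ℂ) * S811 (frakfW c' D j 6) (frakfW c' D j 7) (frakgW c' D j 6) (frakgW c' D j 7)
              (ell D ^ 9) 0.504 (theta2 D)‖
          ≤ ε * alpha D) :
    ∀ ε : ℝ, 0 < ε → ForAllLarge fun D _ χ => ‖χ.LFunction 1‖ ≤ 1 / Real.log D ^ 15 →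
      ∀ j ∈ ({1, 2, 3} : Finset ℕ),
        ‖Sj c' D j (a11 χ) (a21 χ) -
            (frakA χ : ℂ) * S812 (frakfW c' D j 6) (frakfW c' D j 7) (frakgW c' D j 6) (frakgW c' D j 7)
              (ell D ^ 9) 0.504 (theta2 D)‖
          ≤ ε * alpha D := fun ε hε =>
  (h811 ε hε).mono fun D _ χ _ _ h hA j hj => by
    have key := h hA j hj
    rwa [S811_eq_S812 (continuousOn_frakfW c' D j 6) (continuousOn_frakfW c' D j 7)
      (continuousOn_frakgW c' D j 6) (continuousOn_frakgW c' D j 7)] at key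

/-- **(8.11) at (A)-exponent 15, UNCONDITIONAL, every `c′ ≥ 0`** — the body of `Section8cStatements.Eq811 c′` with its guard `AssumptionA D χ`
replaced by `‖L(1,χ)‖ ≤ 𝓛⁻¹⁵`. [cite: Zhang2022LandauSiegel, §8 (8.11) p.48] -/
theorem eq811_pow15 {c' : ℝ} (hc' : 0 ≤ c') :
    ∀ ε : ℝ, 0 < ε → ForAllLarge fun D _ χ => ‖χ.LFunction 1‖ ≤ 1 / Real.log D ^ 15 →
      ∀ j ∈ ({1, 2, 3} : Finset ℕ),
        ‖Sj c' D j (a11 χ) (a21 χ) -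
            (frakA χ : ℂ) * S811 (frakfW c' D j 6) (frakfW c' D j 7) (frakgW c' D j 6) (frakgW c' D j 7)
              (ell D ^ 9) 0.504 (theta2 D)‖
          ≤ ε * alpha D :=
  eq811_pow15_of_step8u046 c' (Section8FrontEnd810.step8u046_pow15 hc')

/-- **(8.12) at (A)-exponent 15, UNCONDITIONAL, every `c′ ≥ 0` — the §8 main-term input `Eq812 c′` of the (8.23) evaluation with its guard
`AssumptionA D χ` replaced by `‖L(1,χ)‖ ≤ 𝓛⁻¹⁵`**: «`S_j(𝐚₁₁,𝐚₂₁) = (𝔞/(log P₁)²)∫₁^{P₁}𝓕_{j6}𝓖_{j6}dx/x + (𝔞|ι₂|²/(log P₂)²)∫₁^{P₂}𝓕_{j7}𝓖_{j7}dx/x + …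
+ o(α)`» for every `ε > 0`, all large `D`, every real primitive `χ (mod D)` with `‖L(1,χ)‖ ≤ 𝓛⁻¹⁵`, `j = 1, 2, 3`.
[cite: Zhang2022LandauSiegel, §8 (8.12) p.48, tex L2473] -/
theorem eq812_pow15 {c' : ℝ} (hc' : 0 ≤ c') :
    ∀ ε : ℝ, 0 < ε → ForAllLarge fun D _ χ => ‖χ.LFunction 1‖ ≤ 1 / Real.log D ^ 15 →
      ∀ j ∈ ({1, 2, 3} : Finset ℕ),
        ‖Sj c' D j (a11 χ) (a21 χ) -
            (frakA χ : ℂ) * S812 (frakfW c' D j 6) (frakfW c' D j 7) (frakgW c' D j 6) (frakgW c' D j 7)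
              (ell D ^ 9) 0.504 (theta2 D)‖
          ≤ ε * alpha D :=
  eq812_pow15_of_eq811 c' (eq811_pow15 hc')

/-- **(8.12) under `Repair.Bed.AssumptionAWith E`, every real `E ≥ 15`, UNCONDITIONAL for `c′ ≥ 0`** (transfer of `eq812_pow15`; at the printed
`E = 2022` this is the body of the tree theorem `Section8FrontEnd44ReductionRel.eq812_of_lemma84Rel hc′ (Skeleton.lemma84Rel_holds c′)`, not
restated). [cite: Zhang2022LandauSiegel, §8 (8.12) p.48] -/
theorem eq812_of_assumptionAWith {c' : ℝ} (hc' : 0 ≤ c') {E : ℝ} (hE : 15 ≤ E) :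
    ∀ ε : ℝ, 0 < ε → ForAllLarge fun D _ χ => Repair.Bed.AssumptionAWith E D χ →
      ∀ j ∈ ({1, 2, 3} : Finset ℕ),
        ‖Sj c' D j (a11 χ) (a21 χ) -
            (frakA χ : ℂ) * S812 (frakfW c' D j 6) (frakfW c' D j 7) (frakgW c' D j 6) (frakgW c' D j 7)
              (ell D ^ 9) 0.504 (theta2 D)‖
          ≤ ε * alpha D :=
  fun ε hε => Repair.Gap.forAllLarge_assumptionAWith_of_pow15 hE (eq812_pow15 hc' ε hε)

end Literature.NumberTheory.LFunctions.Zhang2022.Section8Ded811Engine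

end
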